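import Summits.QuantumFields.BalabanUV.Beta.EriceFlowEnclosureBareSums
import Literature.MathematicalPhysics.QuantumFieldTheory.Balaban1983to89.Beta.Drift

/-!
# Beta / EriceFlowEnclosureBareRun — along ONE enclosed run of Erice's (3.62): the run stays logarithmically close to
# the one-loop model, the two-loop logarithm `Σ_{j<K} g_j² = (log K)/|β₀| + O(1)`, and (3.76) with its constant
# (β-flow team, prover 2 = lower-bound ∕ positivity side, unit `b2b-balaban-beta-bflow-p2`, gen 4; file 2 of 3)

HONEST FRAMING (page 1 of everything the β sub-cell writes): discharging `BetaPertH` makes Bałaban's UV stability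
UNCONDITIONAL — a real constructive-QFT result; it is NOT the continuum limit and NOT the Clay problem.  HONEST DEPENDENCY
(cell reorg 2026-08-19, verbatim): «continuum YM on T⁴ ⇐ BetaPertH ∧ nine spine estimates (0/9 proved); BetaPertH ⇐ (D1) ∧
(D4) ∧ CAP+tail; G-an2-4 gates asym, D1 and NE2/3/4.»  THIS MODULE DISCHARGES NOTHING: it is elementary
discrete analysis over the typed Erice SHAPES of `BalabanJaffe1986.BJ86CouplingRenormalization` (`Recursion362` (3.62),
`telescope370`/`eq374` (3.70)/(3.74) PROVED there, `TaylorSplit373` (3.73)) and the tree's one-loop DRIFT shape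
`Beta.Drift.OneLoopDrift` ([I] (1.3)/(1.22) located hypothesis form, row D1's currency), all entering as HYPOTHESES.

THE SETTING (one run, Erice's letters, argument = g²).  `s n = g_n²` (`n ≤ K`) solves (3.62) `1/g_{n+1}² − 1/g_n² = β_n(g_n²)`
and ends at the final coupling `g_K² = g²` ((3.71)); it lies in the Taylor range `g_n² ≤ s₀` and obeys an ASYMPTOTIC-FREEDOM
LOWER RUNNING `a₁ + b₁(K − n) ≤ 1/g_n²` (`a₁, b₁ > 0`; supplied by (3.69) — file 3 §4: from step 0 it is the left half of
(3.72) with `a₁ = 1/g²`, `b₁ = −β′`; from `n₀` on it holds with a defect, absorbed into smaller `a₁, b₁`).  The inputs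
(i) `TaylorSplit373 βE β₀seq β₂seq C s₀`, (ii) `Drift.OneLoopDrift β₀ A β₀seq` (`|Σ_{j<k} β_{j,0} − β₀k| ≤ A` ∀k),
(iii) `Σ_{n<K′} |β_{n,2} − β₂|/(K′ − n) ≤ A′` ∀K′ are CITATION-FIT R2-F15's (i)–(iii) token for token.

WHAT THIS FILE PROVES (0 sorry; `c := −β₀`, `B₃ := |β₂| + A′ + C s₀`; `β₀ < 0` a HYPOTHESIS here, FORCED in file 3):
§1 `run_pos_le`, `run_le_inv_dist`: `0 < g_n² ≤ 1/(a₁ + b₁(K − n)) ≤ 1/(b₁(K − n))`; `model_sub_inv_eq_sum`: the window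
   identity `(1/g² + c(K − n)) − 1/g_n² = Σ_{i∈[n,K)} (β_i(g_i²) − β₀)` ((3.70)).
§2 `abs_model_sub_inv_le`: `|(1/g² + c(K − n)) − 1/g_n²| ≤ 2A + B₃ Σ_{i∈[n,K)} g_i²` (the run is log-close to the one-loop
   model: drift window bound `Drift.abs_sum_Ico_sub_le_of_drift` + the step deviation);
   `sum_abs_run_sub_invModel_le`: `Σ_{j<K} |g_j² − 1/(1/g² + c(K − j))| ≤ 4A/(b₁c) + 4B₃/(b₁²c)` — NO LOGARITHM survives
   (weight `1/(K − j)²`, exchange of summation (S3), tails (S2));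
   `abs_sum_run_sub_log_le`: `|Σ_{j<K} g_j² − (log K)/c| ≤ 4A/(b₁c) + 4B₃/(b₁²c) + (log(1 + 1/(g²c)) + log(1 + cg²))/c`.
§3 `abs_inv0_sub_model376_le`: `|1/g₀² − (1/g² − β₀K − (β₂/c) log K)| ≤ A + A′/b₁ + 2C/b₁² + |β₂|·(§2 constant)` — (3.76)
   along this run with a `K`-INDEPENDENT constant, by (3.74) `eq374` and the split
   `β_j(g_j²) = β₀ + (β_{j,0} − β₀) + β₂ g_j² + (β_{j,2} − β₂) g_j² + r_j`.
NOT CLAIMED: anything about Bałaban's `β_{k+1}` of [I] (1.22); any value of β₀, β₂; `BetaPertH`; continuum; Clay.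
-/

namespace Summit.QuantumFields.BalabanUV.Beta.EriceFlowEnclosureBareRun

open Literature.MathematicalPhysics.QuantumFieldTheory.Balaban1983to89.Beta
open Literature.MathematicalPhysics.QuantumFieldTheory.BalabanJaffe1986.BJ86CouplingRenormalization
open Summit.QuantumFields.BalabanUV.Beta.EriceFlowEnclosureBareSums

noncomputable section

section OneRun

variable {βE : ℕ → ℝ → ℝ} {β₀seq β₂seq : ℕ → ℝ} {C s₀ β₀ β₂ A A' a₁ b₁ g : ℝ} {s : ℕ → ℝ} {K : ℕ}

/-! ## §1 A-priori consequences of the lower running; the window identity -/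

/-- Positivity of the run and the a-priori bound `g_n² ≤ 1/(a₁ + b₁ (K − n))` from the lower running. -/
theorem run_pos_le (ha₁ : 0 < a₁) (hb₁ : 0 ≤ b₁)
    (hlow : ∀ n, n ≤ K → a₁ + b₁ * ((K : ℝ) - n) ≤ 1 / s n) {n : ℕ} (hn : n ≤ K) :
    0 < s n ∧ s n ≤ 1 / (a₁ + b₁ * ((K : ℝ) - n)) := by
  have hKn : (0 : ℝ) ≤ (K : ℝ) - n := by
    have : (n : ℝ) ≤ K := by exact_mod_cast hn
    linarith
  have hpos : 0 < a₁ + b₁ * ((K : ℝ) - n) := by positivity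
  have h := hlow n hn
  have hs : 0 < s n := by
    rcases lt_trichotomy (s n) 0 with hlt | heq | hgt
    · have : 1 / s n < 0 := one_div_neg.mpr hlt
      linarith
    · rw [heq] at h
      simp at h
      linarith
    · exact hgt
  refine ⟨hs, ?_⟩
  have := one_div_le_one_div_of_le hpos h
  rwa [one_div_one_div] at this

/-- Coarser: `g_n² ≤ 1/(b₁ (K − n))` for `n < K`. -/
theorem run_le_inv_dist (ha₁ : 0 < a₁) (hb₁ : 0 < b₁)
    (hlow : ∀ n, n ≤ K → a₁ + b₁ * ((K : ℝ) - n) ≤ 1 / s n) {n : ℕ} (hn : n < K) :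
    s n ≤ 1 / (b₁ * ((K : ℝ) - n)) := by
  have h1 : (1 : ℝ) ≤ (K : ℝ) - n := by
    have : (n : ℝ) + 1 ≤ K := by exact_mod_cast hn
    linarith
  have h := (run_pos_le ha₁ hb₁.le hlow hn.le).2
  exact h.trans (one_div_le_one_div_of_le (by positivity) (by linarith))

variable (h362 : Recursion362 βE s K) (h371 : s K = g ^ 2)
include h362 h371

/-- The one-loop model minus the run, as a window sum: for `n ≤ K`,
`(1/g² − β₀ (K − n)) − 1/g_n² = Σ_{i ∈ [n, K)} (β_i(g_i²) − β₀)` ((3.70)). -/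
theorem model_sub_inv_eq_sum {n : ℕ} (hn : n ≤ K) :
    (1 / g ^ 2 - β₀ * ((K : ℝ) - n)) - 1 / s n = ∑ i ∈ Finset.Ico n K, (βE i (s i) - β₀) := by
  have htel := telescope370 h362 hn
  rw [h371] at htel
  rw [Finset.sum_sub_distrib, Finset.sum_const, Nat.card_Ico, nsmul_eq_mul, Nat.cast_sub hn]
  linarith



variable (ha₁ : 0 < a₁) (hb₁ : 0 < b₁) (hlow : ∀ n, n ≤ K → a₁ + b₁ * ((K : ℝ) - n) ≤ 1 / s n)
  (hs₀ : ∀ n, n ≤ K → s n ≤ s₀) (hg : 0 < g)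
  (h373 : TaylorSplit373 βE β₀seq β₂seq C s₀) (hii : Drift.OneLoopDrift β₀ A β₀seq)
  (hiii : ∀ K : ℕ, ∑ n ∈ Finset.range K, |β₂seq n - β₂| / ((K : ℝ) - n) ≤ A')
include ha₁ hb₁ hlow hs₀ hg h373 hii hiii

/-! ## §2 The run is log-close to the one-loop model; the two-loop logarithm -/

/-- **The run stays logarithmically close to the one-loop model** — window form: for every `n ≤ K`,
`|(1/g² + (−β₀)(K − n)) − 1/g_n²| ≤ 2A + (|β₂| + A′ + C s₀)·Σ_{i∈[n,K)} g_i²`. -/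
theorem abs_model_sub_inv_le {n : ℕ} (hn : n ≤ K) :
    |(1 / g ^ 2 + (-β₀) * ((K : ℝ) - n)) - 1 / s n| ≤
      2 * A + (|β₂| + A' + C * s₀) * ∑ i ∈ Finset.Ico n K, s i := by
  have hC : 0 ≤ C := by
    have hK := hs₀ K le_rfl
    rw [h371] at hK
    exact taylorConst_nonneg h373 (by positivity) hK
  have e0 : (1 / g ^ 2 + (-β₀) * ((K : ℝ) - n)) - 1 / s n = (1 / g ^ 2 - β₀ * ((K : ℝ) - n)) - 1 / s n := by
    ring
  rw [e0, model_sub_inv_eq_sum h362 h371 hn]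
  have hsplit : ∑ i ∈ Finset.Ico n K, (βE i (s i) - β₀) =
      (∑ i ∈ Finset.Ico n K, β₀seq i - β₀ * ((K : ℝ) - n)) + ∑ i ∈ Finset.Ico n K, (βE i (s i) - β₀seq i) := by
    have e1 : ∀ i ∈ Finset.Ico n K, βE i (s i) - β₀ = (β₀seq i - β₀) + (βE i (s i) - β₀seq i) := by
      intro i _; ring
    rw [Finset.sum_congr rfl e1, Finset.sum_add_distrib, Finset.sum_sub_distrib, Finset.sum_const, Nat.card_Ico,
      nsmul_eq_mul, Nat.cast_sub hn]
    ring
  rw [hsplit]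
  have h1 := Drift.abs_sum_Ico_sub_le_of_drift hii hn
  have h2 : |∑ i ∈ Finset.Ico n K, (βE i (s i) - β₀seq i)| ≤ (|β₂| + A' + C * s₀) * ∑ i ∈ Finset.Ico n K, s i := by
    refine (Finset.abs_sum_le_sum_abs _ _).trans ?_
    rw [Finset.mul_sum]
    refine Finset.sum_le_sum fun i hi => ?_
    have hiK : i ≤ K := (Finset.mem_Ico.mp hi).2.le
    have hpos := (run_pos_le ha₁ hb₁.le hlow hiK).1
    exact abs_step_sub_beta0seq_le h373 hC hiii hpos.le (hs₀ i hiK) i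
  exact (abs_add_le _ _).trans (by linarith)

/-- **Summed two-loop comparison**: `Σ_{j<K} |g_j² − 1/(1/g² + (−β₀)(K − j))| ≤ 4A/(b₁c) + 4B₃/(b₁²c)`, `c = −β₀ > 0`,
`B₃ = |β₂| + A′ + C s₀` — NO logarithm survives (exchange of summation against the weight `1/(K − j)²`). -/
theorem sum_abs_run_sub_invModel_le (hβ₀ : β₀ < 0) :
    ∑ j ∈ Finset.range K, |s j - 1 / (1 / g ^ 2 + (-β₀) * ((K : ℝ) - j))| ≤
      4 * A / (b₁ * (-β₀)) + 4 * (|β₂| + A' + C * s₀) / (b₁ ^ 2 * (-β₀)) := by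
  have hC : 0 ≤ C := by
    have hK := hs₀ K le_rfl
    rw [h371] at hK
    exact taylorConst_nonneg h373 (by positivity) hK
  have hcpos : 0 < -β₀ := by linarith
  have hA : 0 ≤ A := hii.nonneg
  have hA' : 0 ≤ A' := twoLoopRate_nonneg hiii
  have hs₀nn : 0 ≤ s₀ := by
    have := hs₀ K le_rfl; rw [h371] at this; nlinarith
  have hB₃nn : 0 ≤ |β₂| + A' + C * s₀ := by positivity
  -- pointwise bound
  have hpt : ∀ j ∈ Finset.range K, |s j - 1 / (1 / g ^ 2 + (-β₀) * ((K : ℝ) - j))| ≤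
      (2 * A) * (1 / (b₁ * (-β₀)) * (1 / ((K : ℝ) - j) ^ 2)) +
        (|β₂| + A' + C * s₀) / (b₁ * (-β₀)) * ((1 / ((K : ℝ) - j) ^ 2) * ∑ i ∈ Finset.Ico j K, s i) := by
    intro j hj
    have hjK : j < K := Finset.mem_range.mp hj
    have hd : (1 : ℝ) ≤ (K : ℝ) - j := by
      have : (j : ℝ) + 1 ≤ K := by exact_mod_cast hjK
      linarith
    obtain ⟨hspos, _⟩ := run_pos_le ha₁ hb₁.le hlow hjK.le
    have hsle := run_le_inv_dist ha₁ hb₁ hlow hjK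
    have hy : 0 < 1 / g ^ 2 + (-β₀) * ((K : ℝ) - j) := by positivity
    have hyge : (-β₀) * ((K : ℝ) - j) ≤ 1 / g ^ 2 + (-β₀) * ((K : ℝ) - j) := by
      have : 0 < 1 / g ^ 2 := by positivity
      linarith
    have hwin := abs_model_sub_inv_le h362 h371 ha₁ hb₁ hlow hs₀ hg h373 hii hiii hjK.le
    have hT : 0 ≤ ∑ i ∈ Finset.Ico j K, s i :=
      Finset.sum_nonneg fun i hi => (run_pos_le ha₁ hb₁.le hlow (Finset.mem_Ico.mp hi).2.le).1.le
    have hW : 0 ≤ 2 * A + (|β₂| + A' + C * s₀) * ∑ i ∈ Finset.Ico j K, s i := by positivity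
    -- s j - 1/y = s j * (y - 1/s j) / y
    have e1 : s j - 1 / (1 / g ^ 2 + (-β₀) * ((K : ℝ) - j)) =
        s j * ((1 / g ^ 2 + (-β₀) * ((K : ℝ) - j)) - 1 / s j) * (1 / (1 / g ^ 2 + (-β₀) * ((K : ℝ) - j))) := by
      have hy1 : (1 / g ^ 2 + (-β₀) * ((K : ℝ) - j)) * (1 / (1 / g ^ 2 + (-β₀) * ((K : ℝ) - j))) = 1 :=
        mul_one_div_cancel hy.ne'
      have hs1 : s j * (1 / s j) = 1 := mul_one_div_cancel hspos.ne'
      calc s j - 1 / (1 / g ^ 2 + (-β₀) * ((K : ℝ) - j))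
          = s j * ((1 / g ^ 2 + (-β₀) * ((K : ℝ) - j)) * (1 / (1 / g ^ 2 + (-β₀) * ((K : ℝ) - j)))) -
              (s j * (1 / s j)) * (1 / (1 / g ^ 2 + (-β₀) * ((K : ℝ) - j))) := by rw [hy1, hs1]; ring
        _ = _ := by ring
    rw [e1, abs_mul, abs_mul, abs_of_pos hspos, abs_of_pos (one_div_pos.mpr hy)]
    have h3 : 1 / (1 / g ^ 2 + (-β₀) * ((K : ℝ) - j)) ≤ 1 / ((-β₀) * ((K : ℝ) - j)) :=
      one_div_le_one_div_of_le (by positivity) hyge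
    calc s j * |(1 / g ^ 2 + (-β₀) * ((K : ℝ) - j)) - 1 / s j| * (1 / (1 / g ^ 2 + (-β₀) * ((K : ℝ) - j)))
        ≤ (1 / (b₁ * ((K : ℝ) - j))) * (2 * A + (|β₂| + A' + C * s₀) * ∑ i ∈ Finset.Ico j K, s i) *
            (1 / ((-β₀) * ((K : ℝ) - j))) := by
          apply mul_le_mul (mul_le_mul hsle hwin (abs_nonneg _) (by positivity)) h3 (by positivity)
          exact mul_nonneg (by positivity) hW
      _ = (2 * A) * (1 / (b₁ * (-β₀)) * (1 / ((K : ℝ) - j) ^ 2)) +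
            (|β₂| + A' + C * s₀) / (b₁ * (-β₀)) * ((1 / ((K : ℝ) - j) ^ 2) * ∑ i ∈ Finset.Ico j K, s i) := by
          field_simp
          ring
  refine (Finset.sum_le_sum hpt).trans ?_
  rw [Finset.sum_add_distrib, ← Finset.mul_sum, ← Finset.mul_sum, ← Finset.mul_sum,
    sum_range_mul_sum_Ico_comm s (fun j => 1 / ((K : ℝ) - j) ^ 2) K]
  have hS1 := sum_inv_sq_dist_le_two K
  have hinner : ∑ i ∈ Finset.range K, s i * ∑ j ∈ Finset.range (i + 1), 1 / ((K : ℝ) - j) ^ 2 ≤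
      2 / b₁ * ∑ i ∈ Finset.range K, 1 / ((K : ℝ) - i) ^ 2 := by
    rw [Finset.mul_sum]
    refine Finset.sum_le_sum fun i hi => ?_
    have hiK : i < K := Finset.mem_range.mp hi
    have hd : (1 : ℝ) ≤ (K : ℝ) - i := by
      have : (i : ℝ) + 1 ≤ K := by exact_mod_cast hiK
      linarith
    obtain ⟨hspos, _⟩ := run_pos_le ha₁ hb₁.le hlow hiK.le
    have hsle := run_le_inv_dist ha₁ hb₁ hlow hiK
    have hS2 := sum_inv_sq_dist_le hiK
    have hS2nn : 0 ≤ ∑ j ∈ Finset.range (i + 1), 1 / ((K : ℝ) - j) ^ 2 :=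
      Finset.sum_nonneg fun j _ => by positivity
    calc s i * ∑ j ∈ Finset.range (i + 1), 1 / ((K : ℝ) - j) ^ 2
        ≤ (1 / (b₁ * ((K : ℝ) - i))) * (2 / ((K : ℝ) - i)) :=
          mul_le_mul hsle hS2 hS2nn (by positivity)
      _ = 2 / b₁ * (1 / ((K : ℝ) - i) ^ 2) := by field_simp
  have h4 : (|β₂| + A' + C * s₀) / (b₁ * (-β₀)) *
      ∑ i ∈ Finset.range K, s i * ∑ j ∈ Finset.range (i + 1), 1 / ((K : ℝ) - j) ^ 2 ≤
      (|β₂| + A' + C * s₀) / (b₁ * (-β₀)) * (2 / b₁ * 2) := by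
    have hcoef : 0 ≤ (|β₂| + A' + C * s₀) / (b₁ * (-β₀)) := by positivity
    refine mul_le_mul_of_nonneg_left (hinner.trans ?_) hcoef
    exact mul_le_mul_of_nonneg_left hS1 (by positivity)
  have h5 : 2 * A * (1 / (b₁ * (-β₀)) * ∑ i ∈ Finset.range K, 1 / ((K : ℝ) - i) ^ 2) ≤
      2 * A * (1 / (b₁ * (-β₀)) * 2) := by
    have : 0 ≤ 2 * A := by positivity
    refine mul_le_mul_of_nonneg_left ?_ this
    exact mul_le_mul_of_nonneg_left hS1 (by positivity)
  have e2 : 2 * A * (1 / (b₁ * (-β₀)) * 2) + (|β₂| + A' + C * s₀) / (b₁ * (-β₀)) * (2 / b₁ * 2) =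
      4 * A / (b₁ * (-β₀)) + 4 * (|β₂| + A' + C * s₀) / (b₁ ^ 2 * (-β₀)) := by
    field_simp
    ring
  linarith

/-- **Σ_{j<K} g_j² = (1/c)·log K + O(1)** along the run, `c = −β₀`: the two-loop logarithm. -/
theorem abs_sum_run_sub_log_le (hβ₀ : β₀ < 0) :
    |∑ j ∈ Finset.range K, s j - Real.log K / (-β₀)| ≤
      4 * A / (b₁ * (-β₀)) + 4 * (|β₂| + A' + C * s₀) / (b₁ ^ 2 * (-β₀)) +
        (Real.log (1 + (1 / g ^ 2) / (-β₀)) + Real.log (1 + (-β₀) / (1 / g ^ 2))) / (-β₀) := by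
  have ha : 0 < 1 / g ^ 2 := by positivity
  have hc : 0 < -β₀ := by linarith
  have hmain := sum_abs_run_sub_invModel_le h362 h371 ha₁ hb₁ hlow hs₀ hg h373 hii hiii hβ₀
  obtain ⟨hlo, hhi⟩ := log_sandwich_sum_inv_affine ha hc K
  have hl1 : 0 ≤ Real.log (1 + (1 / g ^ 2) / (-β₀)) := Real.log_nonneg (by have := div_pos ha hc; linarith)
  have hl2 : 0 ≤ Real.log (1 + (-β₀) / (1 / g ^ 2)) := Real.log_nonneg (by have := div_pos hc ha; linarith)
  have e : ∑ j ∈ Finset.range K, s j - Real.log K / (-β₀) =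
      ∑ j ∈ Finset.range K, (s j - 1 / (1 / g ^ 2 + (-β₀) * ((K : ℝ) - j))) +
        (∑ j ∈ Finset.range K, 1 / (1 / g ^ 2 + (-β₀) * ((K : ℝ) - j)) - Real.log K / (-β₀)) := by
    rw [Finset.sum_sub_distrib]; ring
  rw [e]
  refine (abs_add_le _ _).trans ?_
  have h1 := (Finset.abs_sum_le_sum_abs (fun j => s j - 1 / (1 / g ^ 2 + (-β₀) * ((K : ℝ) - j)))
    (Finset.range K)).trans hmain
  have h2 : |∑ j ∈ Finset.range K, 1 / (1 / g ^ 2 + (-β₀) * ((K : ℝ) - j)) - Real.log K / (-β₀)| ≤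
      (Real.log (1 + (1 / g ^ 2) / (-β₀)) + Real.log (1 + (-β₀) / (1 / g ^ 2))) / (-β₀) := by
    rw [abs_le]
    constructor
    · have e1 : (Real.log K - Real.log (1 + 1 / g ^ 2 / -β₀)) / -β₀ =
          Real.log K / (-β₀) - Real.log (1 + 1 / g ^ 2 / -β₀) / (-β₀) := by ring
      have : Real.log (1 + 1 / g ^ 2 / -β₀) / (-β₀) ≤
          (Real.log (1 + (1 / g ^ 2) / (-β₀)) + Real.log (1 + (-β₀) / (1 / g ^ 2))) / (-β₀) := by
        gcongr; linarith
      linarith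
    · have e1 : (Real.log K + Real.log (1 + -β₀ / (1 / g ^ 2))) / -β₀ =
          Real.log K / (-β₀) + Real.log (1 + -β₀ / (1 / g ^ 2)) / (-β₀) := by ring
      have : Real.log (1 + -β₀ / (1 / g ^ 2)) / (-β₀) ≤
          (Real.log (1 + (1 / g ^ 2) / (-β₀)) + Real.log (1 + (-β₀) / (1 / g ^ 2))) / (-β₀) := by
        gcongr; linarith
      linarith
  linarith

/-! ## §3 (3.76) along one run, with a `K`-independent constant -/

/-- **(3.76) ALONG ONE ENCLOSED RUN, with its constant.**  For the run with `K` steps ending at `g_K² = g²`: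
`|1/g₀² − (1/g² − β₀K − (β₂/(−β₀)) log K)| ≤ A + A′/b₁ + 2C/b₁² + |β₂|·(two-loop comparison constant)` — the constant
depends on `g, a₁, b₁, β₀, β₂, A, A′, C, s₀` and NOT on `K`. -/
theorem abs_inv0_sub_model376_le (hβ₀ : β₀ < 0) :
    |1 / s 0 - (1 / g ^ 2 - β₀ * K - β₂ / (-β₀) * Real.log K)| ≤
      A + A' / b₁ + 2 * C / b₁ ^ 2 + |β₂| *
        (4 * A / (b₁ * (-β₀)) + 4 * (|β₂| + A' + C * s₀) / (b₁ ^ 2 * (-β₀)) +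
          (Real.log (1 + (1 / g ^ 2) / (-β₀)) + Real.log (1 + (-β₀) / (1 / g ^ 2))) / (-β₀)) := by
  have hC : 0 ≤ C := by
    have hK := hs₀ K le_rfl
    rw [h371] at hK
    exact taylorConst_nonneg h373 (by positivity) hK
  have hx0 := eq374 h362 h371
  have hE4 := abs_sum_run_sub_log_le h362 h371 ha₁ hb₁ hlow hs₀ hg h373 hii hiii hβ₀
  -- the split of the step sum
  have hsplit : ∑ j ∈ Finset.range K, βE j (s j) =
      β₀ * K + (∑ j ∈ Finset.range K, β₀seq j - β₀ * K) + β₂ * ∑ j ∈ Finset.range K, s j +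
        ∑ j ∈ Finset.range K, (β₂seq j - β₂) * s j +
        ∑ j ∈ Finset.range K, (βE j (s j) - β₀seq j - β₂seq j * s j) := by
    have e1 : ∀ j ∈ Finset.range K, βE j (s j) =
        β₀seq j + β₂ * s j + (β₂seq j - β₂) * s j + (βE j (s j) - β₀seq j - β₂seq j * s j) := by
      intro j _; ring
    rw [Finset.sum_congr rfl e1, Finset.sum_add_distrib, Finset.sum_add_distrib, Finset.sum_add_distrib,
      ← Finset.mul_sum]
    ring
  -- (ii): the one-loop drift
  have hE1 : |∑ j ∈ Finset.range K, β₀seq j - β₀ * K| ≤ A := hii K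
  -- (iii): the two-loop rate against g_j² ≤ 1/(b₁ (K − j))
  have hE2 : |∑ j ∈ Finset.range K, (β₂seq j - β₂) * s j| ≤ A' / b₁ := by
    refine (Finset.abs_sum_le_sum_abs _ _).trans ?_
    have hpt : ∀ j ∈ Finset.range K, |(β₂seq j - β₂) * s j| ≤ 1 / b₁ * (|β₂seq j - β₂| / ((K : ℝ) - j)) := by
      intro j hj
      have hjK : j < K := Finset.mem_range.mp hj
      have hd : (1 : ℝ) ≤ (K : ℝ) - j := by
        have : (j : ℝ) + 1 ≤ K := by exact_mod_cast hjK
        linarith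
      obtain ⟨hspos, _⟩ := run_pos_le ha₁ hb₁.le hlow hjK.le
      have hsle := run_le_inv_dist ha₁ hb₁ hlow hjK
      rw [abs_mul, abs_of_pos hspos]
      calc |β₂seq j - β₂| * s j ≤ |β₂seq j - β₂| * (1 / (b₁ * ((K : ℝ) - j))) :=
            mul_le_mul_of_nonneg_left hsle (abs_nonneg _)
        _ = 1 / b₁ * (|β₂seq j - β₂| / ((K : ℝ) - j)) := by
            field_simp
    refine (Finset.sum_le_sum hpt).trans ?_
    rw [← Finset.mul_sum]
    calc 1 / b₁ * ∑ j ∈ Finset.range K, |β₂seq j - β₂| / ((K : ℝ) - j) ≤ 1 / b₁ * A' :=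
          mul_le_mul_of_nonneg_left (hiii K) (by positivity)
      _ = A' / b₁ := by ring
  -- (i): the n-uniform Taylor remainder against Σ 1/(K − j)² ≤ 2
  have hE3 : |∑ j ∈ Finset.range K, (βE j (s j) - β₀seq j - β₂seq j * s j)| ≤ 2 * C / b₁ ^ 2 := by
    refine (Finset.abs_sum_le_sum_abs _ _).trans ?_
    have hpt : ∀ j ∈ Finset.range K, |βE j (s j) - β₀seq j - β₂seq j * s j| ≤
        C / b₁ ^ 2 * (1 / ((K : ℝ) - j) ^ 2) := by
      intro j hj
      have hjK : j < K := Finset.mem_range.mp hj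
      have hd : (1 : ℝ) ≤ (K : ℝ) - j := by
        have : (j : ℝ) + 1 ≤ K := by exact_mod_cast hjK
        linarith
      obtain ⟨hspos, _⟩ := run_pos_le ha₁ hb₁.le hlow hjK.le
      have hsle := run_le_inv_dist ha₁ hb₁ hlow hjK
      have hr := h373 j (s j) hspos.le (hs₀ j hjK.le)
      rw [sub_sub] 
      have hsq : s j ^ 2 ≤ (1 / (b₁ * ((K : ℝ) - j))) ^ 2 := pow_le_pow_left₀ hspos.le hsle 2
      calc |βE j (s j) - (β₀seq j + β₂seq j * s j)| ≤ C * s j ^ 2 := hr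
        _ ≤ C * (1 / (b₁ * ((K : ℝ) - j))) ^ 2 := mul_le_mul_of_nonneg_left hsq hC
        _ = C / b₁ ^ 2 * (1 / ((K : ℝ) - j) ^ 2) := by field_simp
    refine (Finset.sum_le_sum hpt).trans ?_
    rw [← Finset.mul_sum]
    calc C / b₁ ^ 2 * ∑ j ∈ Finset.range K, 1 / ((K : ℝ) - j) ^ 2 ≤ C / b₁ ^ 2 * 2 :=
          mul_le_mul_of_nonneg_left (sum_inv_sq_dist_le_two K) (by positivity)
      _ = 2 * C / b₁ ^ 2 := by ring
  -- assemble
  have hE4' : |β₂ * (∑ j ∈ Finset.range K, s j - Real.log K / (-β₀))| ≤ |β₂| *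
      (4 * A / (b₁ * (-β₀)) + 4 * (|β₂| + A' + C * s₀) / (b₁ ^ 2 * (-β₀)) +
        (Real.log (1 + (1 / g ^ 2) / (-β₀)) + Real.log (1 + (-β₀) / (1 / g ^ 2))) / (-β₀)) := by
    rw [abs_mul]
    exact mul_le_mul_of_nonneg_left hE4 (abs_nonneg _)
  have e : 1 / s 0 - (1 / g ^ 2 - β₀ * K - β₂ / (-β₀) * Real.log K) =
      -(∑ j ∈ Finset.range K, β₀seq j - β₀ * K) - β₂ * (∑ j ∈ Finset.range K, s j - Real.log K / (-β₀)) -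
        ∑ j ∈ Finset.range K, (β₂seq j - β₂) * s j -
        ∑ j ∈ Finset.range K, (βE j (s j) - β₀seq j - β₂seq j * s j) := by
    rw [hx0, hsplit]
    field_simp
    ring
  rw [e]
  have t1 := abs_le.mp hE1
  have t2 := abs_le.mp hE2
  have t3 := abs_le.mp hE3
  have t4 := abs_le.mp hE4'
  rw [abs_le]
  constructor <;> linarith


end OneRun

end

end Summit.QuantumFields.BalabanUV.Beta.EriceFlowEnclosureBareRun
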